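/-
Copyright (c) 2026 the pub-hodgecm-mathlib formalisation cell (harness21).  Prover seat hodgecm-mathlib-F0P2-p02 (g7), topic T5 = P8
«(C♯)hol interior», node Cc (3′) sub-brick S1 «surjectivity of `u ↦ W_u` onto `U(n)` at `M = 1`» (A-p19 (g19) closer road note v4, 2026-08-31).
KERNEL: theorems only (no definition, no named fact, no `sorry`, no instance, no notation).
-/
import Literature.NumberTheory.Automorphic.Liu2021.Def411WeilCarriersArchPlaceSign
import HarnessLib

/-!
# Every unitary `A ∈ U(n)` is the phase matrix `W_u` of some `u ∈ U(σ_{w₀} diag dV)(ℂ)` when `W` is a line (`M = 1`)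
# ([Folland1989, Prop. (4.39)]; [KonnoKonno2007, §3.1]; [PlatonovRapinchuk1994, §2.3])

Topic `NumberTheory/GelbartRogawski1991` (T5 = P8 «(C♯)hol interior», node Cc (3′), sub-brick S1); namespace
`Literature.NumberTheory.GelbartRogawski1991.GRConstruction`.  KERNEL ONLY: proved theorems; 0 definitions, 0 records, 0 `sorry`.

★ `exists_sectionD_archKPlace_apply_of_pos ∕ _of_neg` (β-I, `DoubledWeilRepresentationArchPlacePhase(Neg)`) read Folland's section at the one-place
compact element `k_{v₀,u}`, `u ∈ U(σ_{w₀} diag dV)(ℂ)` (★ `UnitaryGroup.archLocal`), through a unitary `W_u ∈ U(n)` with ENTRIES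
`W i i′ = conj (D_i · ((u ⊗ 1_W)^e)_{i i′} · D_{i′}⁻¹)` (positive pair form at `v₀`; no `conj` for the negative one), `D = √|x_{v₀}|` the adapted scaling
(★ `sqrtAbs`, ★ `signVec`).  The (3′) closer applies the covariance on the Hermite basis for EVERY `A ∈ U(n)` (★ δ
`eq_zero_of_forall_unitaryOpPi_placeBlock_mulSingle_hermitePi`), so it needs the map `u ↦ W_u` to be ONTO `U(n)` — true when `W` is a line (`M = 1`,
`e : Fin N × Fin 1 ≃ Fin n`), which is the (C♯) case `W = ⟨a⟩`:

* **`exists_archLocal_entries_eq_of_pos`** — for `x_{v₀} > 0`: every `A ∈ U(n)` is `W_u` for `u := D′⁻¹ · conj(A^e) · D′` (`D′ = D ∘ e(·, 0)`);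
* **`exists_archLocal_entries_eq_of_neg`** — for `x_{v₀} < 0`: the same with `u := D′⁻¹ · A^e · D′`.

Membership `uᴴ · σ_{w₀}(diag dV) · u = σ_{w₀}(diag dV)` (★ `mem_archLocal_iff_conjTranspose`) holds because `σ_{w₀}(dV p) = c · D′_p²` for ONE real constant
`c = ± Im σ_{w₀}(δ) ∕ σ_{v₀}(dW 0)` (★ `signVec_cmGramEntry_eq`, ★ `sqrtAbs_sq`, ★ `ofReal_realPlaceMap`, ★ `realPlaceMap_eq_embedding_of_isReal`), so that
`uᴴ J u = c · D′ Bᴴ B D′ = c · D′² = J` for the unitary `B = conj(A^e)` (resp. `A^e`).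

HONEST SCOPE.  Statements about the tree's own archimedean unitary groups; nothing of [Liu2021] is asserted; this file books nothing and discharges
nothing booked (sub-brick S1 of the in-house node Cc of the booked letter (C♯)hol).  HC_CM is proved only modulo the printed citations until rung 0 closes.

## References
* [Folland1989] G. B. Folland, *Harmonic Analysis in Phase Space* (1989), §4.2 Prop. (4.39) (the metaplectic section over `U(n)`).
* [KonnoKonno2007] K. Konno, T. Konno, Kyushu J. Math. 61 (2007), §3.1 (3.1) (sign frames of a hermitian form at a real place).
* [PlatonovRapinchuk1994] V. Platonov, A. Rapinchuk, *Algebraic Groups and Number Theory* (1994), §2.3 (unitary groups of hermitian forms at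
  archimedean places).
* [Liu2021] Y. Liu, Camb. J. Math. 9 (2021) = arXiv:2102.11518, App. D Lem. D.2 (1).
-/

set_option autoImplicit false

noncomputable section

open scoped Classical
open scoped Matrix Kronecker ComplexOrder
open NumberField NumberField.InfinitePlace
open Literature.NumberTheory.Automorphic Literature.NumberTheory.Automorphic.UnitaryGroup
open Literature.NumberTheory.Weil1964

namespace Literature.NumberTheory.GelbartRogawski1991.GRConstruction

open UnitaryDualPair

variable (L : Type) [Field L] [NumberField L] [IsCMField L]

variable {N n : ℕ} (e : Fin N × Fin 1 ≃ Fin n)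
  (dV : Fin N → L) (hdV : ∀ i, IsCMField.complexConj L (dV i) = dV i) (hdV0 : ∀ i, dV i ≠ 0)
  (dW : Fin 1 → L) (hdW : ∀ i, IsCMField.complexConj L (dW i) = dW i) (hdW0 : ∀ i, dW i ≠ 0)
  (v₀ : {v : InfinitePlace (Fp L) // v.IsReal})

/-! ## §1 The matrix algebra: `uᴴ · diag(c D′²) · u = diag(c D′²)` for `u = D′⁻¹ B D′`, `Bᴴ B = 1`, `D′` real -/

section Algebra

omit [NumberField L] [IsCMField L] in
/-- `uᴴ J u = J` for `u p q = D_p⁻¹ B p q D_q`, `J = diag (c · D_p²)`, `Bᴴ B = 1`, `D` real and non-vanishing (entrywise computation). [folklore] -/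
private theorem conjTranspose_mul_diagonal_mul_eq {N : ℕ} (B u : Matrix (Fin N) (Fin N) ℂ) (hB : Bᴴ * B = 1) (d : Fin N → ℂ)
    (hd0 : ∀ p, d p ≠ 0) (hdr : ∀ p, star (d p) = d p) (c : ℂ) (hu : ∀ p q, u p q = (d p)⁻¹ * B p q * d q) :
    uᴴ * Matrix.diagonal (fun p => c * (d p * d p)) * u = Matrix.diagonal (fun p => c * (d p * d p)) := by
  ext p q
  have hBB : ∀ p q : Fin N, ∑ l, star (B l p) * B l q = (1 : Matrix (Fin N) (Fin N) ℂ) p q := fun p q => by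
    rw [← hB, Matrix.mul_apply]
    rfl
  rw [Matrix.mul_apply]
  have hterm : ∀ l : Fin N, (uᴴ * Matrix.diagonal (fun p => c * (d p * d p))) p l * u l q = (c * d p * d q) * (star (B l p) * B l q) := fun l => by
    rw [Matrix.mul_diagonal, Matrix.conjTranspose_apply, hu, hu, star_mul, star_mul, star_inv₀, hdr l, hdr p]
    field_simp [hd0 l]
  rw [Finset.sum_congr rfl fun l _ => hterm l, ← Finset.mul_sum, hBB, Matrix.diagonal_apply, Matrix.one_apply]
  split_ifs with h
  · subst h; ring
  · rw [mul_zero]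

omit [NumberField L] [IsCMField L] in
/-- `B := conj (Aᵉ)` satisfies `Bᴴ B = 1` for a unitary `A` reindexed along `f : Fin N ≃ Fin n`. [folklore] -/
private theorem conjTranspose_mul_self_conj_submatrix {N n : ℕ} (f : Fin N ≃ Fin n) (A : Matrix.unitaryGroup (Fin n) ℂ) :
    (((A : Matrix (Fin n) (Fin n) ℂ).submatrix f f).map star)ᴴ * ((A : Matrix (Fin n) (Fin n) ℂ).submatrix f f).map star = 1 := by
  have hA : star (A : Matrix (Fin n) (Fin n) ℂ) * (A : Matrix (Fin n) (Fin n) ℂ) = 1 := Matrix.mem_unitaryGroup_iff'.1 A.2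
  have hA' : (A : Matrix (Fin n) (Fin n) ℂ)ᴴ * (A : Matrix (Fin n) (Fin n) ℂ) = 1 := hA
  -- `conj M = (Mᵀ)ᴴ`, so `(conj M)ᴴ (conj M) = (Mᴴ M)ᵀ`
  have h1 : (((A : Matrix (Fin n) (Fin n) ℂ).submatrix f f).map star)ᴴ * ((A : Matrix (Fin n) (Fin n) ℂ).submatrix f f).map star =
      ((((A : Matrix (Fin n) (Fin n) ℂ).submatrix f f)ᴴ * (A : Matrix (Fin n) (Fin n) ℂ).submatrix f f))ᵀ := by
    ext p q
    simp only [Matrix.mul_apply, Matrix.transpose_apply, Matrix.conjTranspose_apply, Matrix.map_apply, star_star]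
    exact Finset.sum_congr rfl fun l _ => mul_comm _ _
  rw [h1, Matrix.conjTranspose_submatrix, Matrix.submatrix_mul_equiv, hA', Matrix.submatrix_one_equiv, Matrix.transpose_one]

omit [NumberField L] [IsCMField L] in
/-- `B := Aᵉ` satisfies `Bᴴ B = 1` for a unitary `A` reindexed along `f : Fin N ≃ Fin n`. [folklore] -/
private theorem conjTranspose_mul_self_submatrix {N n : ℕ} (f : Fin N ≃ Fin n) (A : Matrix.unitaryGroup (Fin n) ℂ) :
    ((A : Matrix (Fin n) (Fin n) ℂ).submatrix f f)ᴴ * (A : Matrix (Fin n) (Fin n) ℂ).submatrix f f = 1 := by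
  have hA : star (A : Matrix (Fin n) (Fin n) ℂ) * (A : Matrix (Fin n) (Fin n) ℂ) = 1 := Matrix.mem_unitaryGroup_iff'.1 A.2
  have hA' : (A : Matrix (Fin n) (Fin n) ℂ)ᴴ * (A : Matrix (Fin n) (Fin n) ℂ) = 1 := hA
  rw [Matrix.conjTranspose_submatrix, Matrix.submatrix_mul_equiv, hA', Matrix.submatrix_one_equiv]

end Algebra

/-! ## §2 The scalar dictionary at the place: `σ_{w₀}(dV p) = c · D_{e(p,0)}²` -/

section Scalar

/-- the sign vector along the line: `x_{v₀}(e(p, 0)) = σ_{v₀}(dV p) · σ_{v₀}(dW 0) ∕ Im σ_{w₀}(δ)` (★ `signVec_cmGramEntry_eq` at `M = 1`).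
[cite: KonnoKonno2007, §3.1 (3.1)] -/
theorem signVec_cmGramEntry_line_apply (p : Fin N) :
    signVec (cmPlaceOver L) (cmGramEntry L e dV hdV dW hdW) (imagUnit L) v₀ (e (p, 0)) =
      embedding_of_isReal v₀.2 (⟨dV p, (IsCMField.complexConj_eq_self_iff (K := L) (dV p)).1 (hdV p)⟩ : Fp L) *
        embedding_of_isReal v₀.2 (⟨dW 0, (IsCMField.complexConj_eq_self_iff (K := L) (dW 0)).1 (hdW 0)⟩ : Fp L) /
        deltaIm (cmPlaceOver L) (imagUnit L) v₀ := by
  rw [signVec_cmGramEntry_eq]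
  simp only [Equiv.symm_apply_apply]

/-- `σ_{w₀}(dV p) = σ_{v₀}(dV p)` as a complex number (the complex place `w₀ = cmPlaceOver L v₀` lies over the real place `v₀`; ★ `ofReal_realPlaceMap`,
★ `realPlaceMap_eq_embedding_of_isReal`). [cite: PlatonovRapinchuk1994, §2.3] -/
theorem embedding_cmPlaceOver_dV (p : Fin N) :
    (cmPlaceOver L v₀).1.embedding (dV p) =
      ((embedding_of_isReal v₀.2 (⟨dV p, (IsCMField.complexConj_eq_self_iff (K := L) (dV p)).1 (hdV p)⟩ : Fp L) : ℝ) : ℂ) := by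
  rw [← realPlaceMap_eq_embedding_of_isReal L (IsCMField.complexConj L) (cmPlaceOver L v₀) (cmPlaceOver_smul L v₀)
    (IsCMField.complexConj_ne_one L) v₀ (cmPlaceOver_comap L v₀), UnitaryGroup.ofReal_realPlaceMap]
  rfl

end Scalar

/-! ## §3 Surjectivity of `u ↦ W_u` -/

section Surjective

include hdV0 in
/-- core: from a unitary-type `B` (`Bᴴ B = 1`) and ONE real `c` with `σ_{w₀}(dV p) = c · D_{e(p,0)}²`, the matrix `u = D′⁻¹ B D′` is an element of
`U(σ_{w₀} diag dV)(ℂ)` with the displayed entries. [folklore] -/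
private theorem exists_archLocal_coe_eq (B : Matrix (Fin N) (Fin N) ℂ) (hB : Bᴴ * B = 1) (c : ℝ)
    (hx0 : ∀ k, signVec (cmPlaceOver L) (cmGramEntry L e dV hdV dW hdW) (imagUnit L) v₀ k ≠ 0)
    (hc : ∀ p : Fin N, (cmPlaceOver L v₀).1.embedding (dV p) = (c : ℂ) * ((((sqrtAbs (signVec (cmPlaceOver L) (cmGramEntry L e dV hdV dW hdW) (imagUnit L) v₀) (e (p, 0)) : ℝ) : ℂ)) * (((sqrtAbs (signVec (cmPlaceOver L) (cmGramEntry L e dV hdV dW hdW) (imagUnit L) v₀) (e (p, 0)) : ℝ) : ℂ)))) :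
    ∃ u : UnitaryGroup.archLocal L N (Matrix.diagonal dV) (cmPlaceOver L v₀),
      (((u : UnitaryGroup.archLocal L N (Matrix.diagonal dV) (cmPlaceOver L v₀)) : GL (Fin N) ℂ) : Matrix (Fin N) (Fin N) ℂ) =
        Matrix.of (fun p q : Fin N => ((((sqrtAbs (signVec (cmPlaceOver L) (cmGramEntry L e dV hdV dW hdW) (imagUnit L) v₀) (e (p, 0)) : ℝ) : ℂ)))⁻¹ * B p q * (((sqrtAbs (signVec (cmPlaceOver L) (cmGramEntry L e dV hdV dW hdW) (imagUnit L) v₀) (e (q, 0)) : ℝ) : ℂ))) := by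
  have hd0 : ∀ p : Fin N, (((sqrtAbs (signVec (cmPlaceOver L) (cmGramEntry L e dV hdV dW hdW) (imagUnit L) v₀) (e (p, 0)) : ℝ) : ℂ)) ≠ 0 := fun p => Complex.ofReal_ne_zero.2 (sqrtAbs_ne_zero (hx0 _))
  have hdr : ∀ p : Fin N, star (((sqrtAbs (signVec (cmPlaceOver L) (cmGramEntry L e dV hdV dW hdW) (imagUnit L) v₀) (e (p, 0)) : ℝ) : ℂ)) = (((sqrtAbs (signVec (cmPlaceOver L) (cmGramEntry L e dV hdV dW hdW) (imagUnit L) v₀) (e (p, 0)) : ℝ) : ℂ)) := fun p => Complex.conj_ofReal _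
  have hJ : (Matrix.diagonal dV).map (cmPlaceOver L v₀).1.embedding =
      Matrix.diagonal (fun p : Fin N => (c : ℂ) * ((((sqrtAbs (signVec (cmPlaceOver L) (cmGramEntry L e dV hdV dW hdW) (imagUnit L) v₀) (e (p, 0)) : ℝ) : ℂ)) * (((sqrtAbs (signVec (cmPlaceOver L) (cmGramEntry L e dV hdV dW hdW) (imagUnit L) v₀) (e (p, 0)) : ℝ) : ℂ)))) := by
    rw [Matrix.diagonal_map (map_zero _)]
    exact congrArg Matrix.diagonal (funext fun p => hc p)
  have hmem : (Matrix.of (fun p q : Fin N => ((((sqrtAbs (signVec (cmPlaceOver L) (cmGramEntry L e dV hdV dW hdW) (imagUnit L) v₀) (e (p, 0)) : ℝ) : ℂ)))⁻¹ * B p q * (((sqrtAbs (signVec (cmPlaceOver L) (cmGramEntry L e dV hdV dW hdW) (imagUnit L) v₀) (e (q, 0)) : ℝ) : ℂ))))ᴴ *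
      (Matrix.diagonal dV).map (cmPlaceOver L v₀).1.embedding *
        Matrix.of (fun p q : Fin N => ((((sqrtAbs (signVec (cmPlaceOver L) (cmGramEntry L e dV hdV dW hdW) (imagUnit L) v₀) (e (p, 0)) : ℝ) : ℂ)))⁻¹ * B p q * (((sqrtAbs (signVec (cmPlaceOver L) (cmGramEntry L e dV hdV dW hdW) (imagUnit L) v₀) (e (q, 0)) : ℝ) : ℂ))) =
      (Matrix.diagonal dV).map (cmPlaceOver L v₀).1.embedding := by
    rw [hJ]
    exact conjTranspose_mul_diagonal_mul_eq B _ hB (fun p => (((sqrtAbs (signVec (cmPlaceOver L) (cmGramEntry L e dV hdV dW hdW) (imagUnit L) v₀) (e (p, 0)) : ℝ) : ℂ))) hd0 hdr c (fun p q => rfl)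
  -- `det u ≠ 0`: `det uᴴ · det J · det u = det J ≠ 0`
  have hJdet : ((Matrix.diagonal dV).map (cmPlaceOver L v₀).1.embedding).det ≠ 0 := by
    rw [Matrix.diagonal_map (map_zero _), Matrix.det_diagonal]
    exact Finset.prod_ne_zero_iff.2 fun p _ => (map_ne_zero _).2 (hdV0 p)
  have hdet : (Matrix.of (fun p q : Fin N => ((((sqrtAbs (signVec (cmPlaceOver L) (cmGramEntry L e dV hdV dW hdW) (imagUnit L) v₀) (e (p, 0)) : ℝ) : ℂ)))⁻¹ * B p q * (((sqrtAbs (signVec (cmPlaceOver L) (cmGramEntry L e dV hdV dW hdW) (imagUnit L) v₀) (e (q, 0)) : ℝ) : ℂ)))).det ≠ 0 := by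
    intro h0
    have h := congrArg Matrix.det hmem
    rw [Matrix.det_mul, Matrix.det_mul, h0, mul_zero] at h
    exact hJdet h.symm
  refine ⟨⟨Matrix.GeneralLinearGroup.mkOfDetNeZero _ hdet, ?_⟩, ?_⟩
  · rw [UnitaryGroup.mem_archLocal_iff_conjTranspose, Matrix.GeneralLinearGroup.val_mkOfDetNeZero]
    exact hmem
  · rw [Matrix.GeneralLinearGroup.val_mkOfDetNeZero]

include hdV0 hdW0 in
/-- the sign vector does not vanish (`dV, dW ≠ 0`, `Im σ_{w₀}(δ) ≠ 0`). [folklore] -/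
private theorem signVec_line_ne_zero (k : Fin n) : signVec (cmPlaceOver L) (cmGramEntry L e dV hdV dW hdW) (imagUnit L) v₀ k ≠ 0 :=
  signVec_ne_zero (IsCMField.complexConj_ne_one L) (cmPlaceOver_smul L) (complexConj_imagUnit L) (imagUnit_ne_zero L)
    (cmGramEntry_ne_zero L e dV hdV dW hdW hdV0 hdW0) v₀ k

include hdW0 in
/-- `σ_{v₀}(dW 0) ≠ 0`. [folklore] -/
private theorem embedding_of_isReal_dW_ne_zero :
    embedding_of_isReal v₀.2 (⟨dW 0, (IsCMField.complexConj_eq_self_iff (K := L) (dW 0)).1 (hdW 0)⟩ : Fp L) ≠ 0 := by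
  refine (map_ne_zero_iff _ (RingHom.injective _)).2 ?_
  exact fun h => hdW0 0 (congrArg Subtype.val h)

include hdV0 hdW0 in
/-- **SUB-BRICK S1, POSITIVE PAIR FORM AT `v₀`: every `A ∈ U(n)` is `W_u` for some `u ∈ U(σ_{w₀} diag dV)(ℂ)`** — with the entry formula of
★ `exists_sectionD_archKPlace_apply_of_pos` at `M = 1` token for token (A-p19's `hS1` orientation): `conj (D_i · ((u ⊗ 1)^e)_{i i′} · D_{i′}⁻¹) = A i i′`.  Construction
`u := D′⁻¹ · conj(A^e) · D′`, `D′_p = D_{e(p,0)}`; membership because `σ_{w₀}(dV p) = (Im σ_{w₀}δ ∕ σ_{v₀}(dW 0)) · D′_p²` when `x_{v₀} > 0`.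
[cite: Folland1989, §4.2 Prop. (4.39)] [cite: KonnoKonno2007, §3.1 (3.1)] [cite: PlatonovRapinchuk1994, §2.3] -/
theorem exists_archLocal_entries_eq_of_pos
    (hpos : ∀ k : Fin n, 0 < signVec (cmPlaceOver L) (cmGramEntry L e dV hdV dW hdW) (imagUnit L) v₀ k)
    (A : Matrix.unitaryGroup (Fin n) ℂ) :
    ∃ u : UnitaryGroup.archLocal L N (Matrix.diagonal dV) (cmPlaceOver L v₀),
      ∀ i i' : Fin n,
        star ((((sqrtAbs (signVec (cmPlaceOver L) (cmGramEntry L e dV hdV dW hdW) (imagUnit L) v₀) i : ℝ) : ℂ)) *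
          Matrix.reindex e e
            ((((u : UnitaryGroup.archLocal L N (Matrix.diagonal dV) (cmPlaceOver L v₀)) : GL (Fin N) ℂ) : Matrix (Fin N) (Fin N) ℂ) ⊗ₖ
              (1 : Matrix (Fin 1) (Fin 1) ℂ)) i i' *
          ((((sqrtAbs (signVec (cmPlaceOver L) (cmGramEntry L e dV hdV dW hdW) (imagUnit L) v₀) i' : ℝ) : ℂ)))⁻¹) = (A : Matrix (Fin n) (Fin n) ℂ) i i' := by
  have hx0 := signVec_line_ne_zero L e dV hdV hdV0 dW hdW hdW0 v₀
  -- the reindexing `f p := e (p, 0)` as an equivalence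
  let f : Fin N ≃ Fin n := (Equiv.prodUnique (Fin N) (Fin 1)).symm.trans e
  have hf : ∀ p, f p = e (p, 0) := fun p => rfl
  have hs0 := embedding_of_isReal_dW_ne_zero L dW hdW hdW0 v₀
  have hδ0 : deltaIm (cmPlaceOver L) (imagUnit L) v₀ ≠ 0 :=
    deltaIm_ne_zero (IsCMField.complexConj_ne_one L) (cmPlaceOver_smul L) (complexConj_imagUnit L) (imagUnit_ne_zero L) v₀
  -- `σ_{w₀}(dV p) = (δ / s) · D_{e(p,0)}²`
  have hc : ∀ p : Fin N, (cmPlaceOver L v₀).1.embedding (dV p) =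
      ((deltaIm (cmPlaceOver L) (imagUnit L) v₀ /
          embedding_of_isReal v₀.2 (⟨dW 0, (IsCMField.complexConj_eq_self_iff (K := L) (dW 0)).1 (hdW 0)⟩ : Fp L) : ℝ) : ℂ) *
        ((((sqrtAbs (signVec (cmPlaceOver L) (cmGramEntry L e dV hdV dW hdW) (imagUnit L) v₀) (e (p, 0)) : ℝ) : ℂ)) * (((sqrtAbs (signVec (cmPlaceOver L) (cmGramEntry L e dV hdV dW hdW) (imagUnit L) v₀) (e (p, 0)) : ℝ) : ℂ))) := fun p => by
    rw [embedding_cmPlaceOver_dV L dV hdV v₀ p, ← Complex.ofReal_mul, ← Complex.ofReal_mul]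
    congr 1
    have hsq : sqrtAbs (signVec (cmPlaceOver L) (cmGramEntry L e dV hdV dW hdW) (imagUnit L) v₀) (e (p, 0)) * sqrtAbs (signVec (cmPlaceOver L) (cmGramEntry L e dV hdV dW hdW) (imagUnit L) v₀) (e (p, 0)) = signVec (cmPlaceOver L) (cmGramEntry L e dV hdV dW hdW) (imagUnit L) v₀ (e (p, 0)) := by
      rw [← sq, sqrtAbs_sq, abs_of_pos (hpos _)]
    rw [hsq, signVec_cmGramEntry_line_apply L e dV hdV dW hdW v₀ p]
    field_simp
  obtain ⟨u, hu⟩ := exists_archLocal_coe_eq L e dV hdV hdV0 dW hdW v₀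
    (((A : Matrix (Fin n) (Fin n) ℂ).submatrix f f).map star) (conjTranspose_mul_self_conj_submatrix f A) _ hx0 hc
  refine ⟨u, fun i i' => Eq.symm ?_⟩
  -- `e⁻¹ i = ((e⁻¹ i).1, 0)` so that `f (e⁻¹ i).1 = i`
  have hi : ∀ j : Fin n, e ((e.symm j).1, 0) = j := fun j => by
    have : ((e.symm j).1, (0 : Fin 1)) = e.symm j := Prod.ext rfl (Subsingleton.elim _ _)
    rw [this, Equiv.apply_symm_apply]
  have h1 : (1 : Matrix (Fin 1) (Fin 1) ℂ) (e.symm i).2 (e.symm i').2 = 1 := by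
    rw [Subsingleton.elim (e.symm i).2 (e.symm i').2, Matrix.one_apply_eq]
  rw [Matrix.reindex_apply, Matrix.submatrix_apply, Matrix.kroneckerMap_apply, hu, h1, Matrix.of_apply, Matrix.map_apply,
    Matrix.submatrix_apply, hf, hf, hi, hi, mul_one]
  have hDi : (((sqrtAbs (signVec (cmPlaceOver L) (cmGramEntry L e dV hdV dW hdW) (imagUnit L) v₀) i : ℝ) : ℂ)) ≠ 0 := Complex.ofReal_ne_zero.2 (sqrtAbs_ne_zero (hx0 _))
  have hDi' : (((sqrtAbs (signVec (cmPlaceOver L) (cmGramEntry L e dV hdV dW hdW) (imagUnit L) v₀) i' : ℝ) : ℂ)) ≠ 0 := Complex.ofReal_ne_zero.2 (sqrtAbs_ne_zero (hx0 _))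
  rw [star_mul, star_mul, star_mul, star_mul, star_star, star_inv₀, star_inv₀]
  simp only [Complex.star_def, Complex.conj_ofReal]
  field_simp

include hdV0 hdW0 in
/-- **SUB-BRICK S1, NEGATIVE PAIR FORM AT `v₀`: every `A ∈ U(n)` is `W_u` for some `u ∈ U(σ_{w₀} diag dV)(ℂ)`** — with the entry formula of
★ `exists_sectionD_archKPlace_apply_of_neg` at `M = 1` token for token: `D_i · ((u ⊗ 1)^e)_{i i′} · D_{i′}⁻¹ = A i i′`.  Construction `u := D′⁻¹ · A^e · D′`;
membership because `σ_{w₀}(dV p) = −(Im σ_{w₀}δ ∕ σ_{v₀}(dW 0)) · D′_p²` when `x_{v₀} < 0`.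
[cite: Folland1989, §4.2 Prop. (4.39)] [cite: KonnoKonno2007, §3.1 (3.1)] [cite: PlatonovRapinchuk1994, §2.3] -/
theorem exists_archLocal_entries_eq_of_neg
    (hneg : ∀ k : Fin n, ¬ 0 < signVec (cmPlaceOver L) (cmGramEntry L e dV hdV dW hdW) (imagUnit L) v₀ k)
    (A : Matrix.unitaryGroup (Fin n) ℂ) :
    ∃ u : UnitaryGroup.archLocal L N (Matrix.diagonal dV) (cmPlaceOver L v₀),
      ∀ i i' : Fin n,
        (((sqrtAbs (signVec (cmPlaceOver L) (cmGramEntry L e dV hdV dW hdW) (imagUnit L) v₀) i : ℝ) : ℂ)) *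
          Matrix.reindex e e
            ((((u : UnitaryGroup.archLocal L N (Matrix.diagonal dV) (cmPlaceOver L v₀)) : GL (Fin N) ℂ) : Matrix (Fin N) (Fin N) ℂ) ⊗ₖ
              (1 : Matrix (Fin 1) (Fin 1) ℂ)) i i' *
          ((((sqrtAbs (signVec (cmPlaceOver L) (cmGramEntry L e dV hdV dW hdW) (imagUnit L) v₀) i' : ℝ) : ℂ)))⁻¹ = (A : Matrix (Fin n) (Fin n) ℂ) i i' := by
  have hx0 := signVec_line_ne_zero L e dV hdV hdV0 dW hdW hdW0 v₀
  have hlt : ∀ k, signVec (cmPlaceOver L) (cmGramEntry L e dV hdV dW hdW) (imagUnit L) v₀ k < 0 := fun k => lt_of_le_of_ne (not_lt.1 (hneg k)) (hx0 k)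
  let f : Fin N ≃ Fin n := (Equiv.prodUnique (Fin N) (Fin 1)).symm.trans e
  have hf : ∀ p, f p = e (p, 0) := fun p => rfl
  have hs0 := embedding_of_isReal_dW_ne_zero L dW hdW hdW0 v₀
  have hδ0 : deltaIm (cmPlaceOver L) (imagUnit L) v₀ ≠ 0 :=
    deltaIm_ne_zero (IsCMField.complexConj_ne_one L) (cmPlaceOver_smul L) (complexConj_imagUnit L) (imagUnit_ne_zero L) v₀
  -- `σ_{w₀}(dV p) = (−δ / s) · D_{e(p,0)}²`
  have hc : ∀ p : Fin N, (cmPlaceOver L v₀).1.embedding (dV p) =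
      ((-deltaIm (cmPlaceOver L) (imagUnit L) v₀ /
          embedding_of_isReal v₀.2 (⟨dW 0, (IsCMField.complexConj_eq_self_iff (K := L) (dW 0)).1 (hdW 0)⟩ : Fp L) : ℝ) : ℂ) *
        ((((sqrtAbs (signVec (cmPlaceOver L) (cmGramEntry L e dV hdV dW hdW) (imagUnit L) v₀) (e (p, 0)) : ℝ) : ℂ)) * (((sqrtAbs (signVec (cmPlaceOver L) (cmGramEntry L e dV hdV dW hdW) (imagUnit L) v₀) (e (p, 0)) : ℝ) : ℂ))) := fun p => by
    rw [embedding_cmPlaceOver_dV L dV hdV v₀ p, ← Complex.ofReal_mul, ← Complex.ofReal_mul]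
    congr 1
    have hsq : sqrtAbs (signVec (cmPlaceOver L) (cmGramEntry L e dV hdV dW hdW) (imagUnit L) v₀) (e (p, 0)) * sqrtAbs (signVec (cmPlaceOver L) (cmGramEntry L e dV hdV dW hdW) (imagUnit L) v₀) (e (p, 0)) = -signVec (cmPlaceOver L) (cmGramEntry L e dV hdV dW hdW) (imagUnit L) v₀ (e (p, 0)) := by
      rw [← sq, sqrtAbs_sq, abs_of_neg (hlt _)]
    rw [hsq, signVec_cmGramEntry_line_apply L e dV hdV dW hdW v₀ p]
    field_simp
  obtain ⟨u, hu⟩ := exists_archLocal_coe_eq L e dV hdV hdV0 dW hdW v₀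
    ((A : Matrix (Fin n) (Fin n) ℂ).submatrix f f) (conjTranspose_mul_self_submatrix f A) _ hx0 hc
  refine ⟨u, fun i i' => Eq.symm ?_⟩
  have hi : ∀ j : Fin n, e ((e.symm j).1, 0) = j := fun j => by
    have : ((e.symm j).1, (0 : Fin 1)) = e.symm j := Prod.ext rfl (Subsingleton.elim _ _)
    rw [this, Equiv.apply_symm_apply]
  have h1 : (1 : Matrix (Fin 1) (Fin 1) ℂ) (e.symm i).2 (e.symm i').2 = 1 := by
    rw [Subsingleton.elim (e.symm i).2 (e.symm i').2, Matrix.one_apply_eq]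
  rw [Matrix.reindex_apply, Matrix.submatrix_apply, Matrix.kroneckerMap_apply, hu, h1, Matrix.of_apply,
    Matrix.submatrix_apply, hf, hf, hi, hi, mul_one]
  have hDi : (((sqrtAbs (signVec (cmPlaceOver L) (cmGramEntry L e dV hdV dW hdW) (imagUnit L) v₀) i : ℝ) : ℂ)) ≠ 0 := Complex.ofReal_ne_zero.2 (sqrtAbs_ne_zero (hx0 _))
  have hDi' : (((sqrtAbs (signVec (cmPlaceOver L) (cmGramEntry L e dV hdV dW hdW) (imagUnit L) v₀) i' : ℝ) : ℂ)) ≠ 0 := Complex.ofReal_ne_zero.2 (sqrtAbs_ne_zero (hx0 _))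
  field_simp

end Surjective

end Literature.NumberTheory.GelbartRogawski1991.GRConstruction

end
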